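import Mathlib
import Summits.Ventures.PercRepro.TriangleCapThreeRowSecondBestCherries

/-!
# PercRepro — THE DIAGONAL `r = 0` OF THE ROW `a = 3` AT SECOND ORDER: a `K₄⁻`-free graph with `3 (k − 3)` edges
on `k ≥ 7` vertices is a spanning subgraph of some `K(A, Aᶜ)`, `|A| = 3`, or at least `6 (k − 7)` below `m k` —
the other bipartition `K_{4,k−4}` minus a `(k − 7)`-star is sharp, so THE SECOND-BEST VALUE OF THE WHOLE ROW `a = 3`
is known (p3, gen 43; part 194)

Part 191 gives `2 (k − 6)` on the diagonal; the census says `6 (k − 7)` (§10bt(e): `B2 = 2 (k − 2a − 1)(a − r)` at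
`a = 3`, `r = 0`). The proof is an induction on `k` (every vertex type): a vertex at the cap `k − 3` makes `D`
`3`-bipartite (part 190 at `r = 0`); every degree in `[4, k − 4]` gives `k (k − 7)` by the convexity of the row
`a = 4` (`(d − 4)(k − 4 − d) ≥ 0`); a vertex `z` of degree `3` is deleted onto the diagonal at `k − 1`: `D − z` is
`3`-bipartite — then it is `K_{3,k−4}` (no missing cross pair), `z` has its three neighbours on one side by
`K₄⁻`-freeness (two on one side and one on the other make two triangles on an edge at `z`), on the small side `D`
is `3`-bipartite and on the large side `D` is `K_{4,k−4}` minus a star, exactly `6 (k − 7)` below — or `D − z` is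
`6 (k − 8)` below its `m' (k − 1)` and the neighbours of `z` at `≤ k − 5` close the count exactly; a vertex of
degree `≤ 2` is the cross-row deletion of part 191 with the stronger target (`cross_arith_zero`). The witness is
`bipMinusStar k 4 (k − 7)` (`sums_bipMinusStar`). `three_row_second_best_zero (8 ≤ k)`: the second-best value of
`Σ_v d(v)²` over the non-extremal `K₄⁻`-free graphs on `Fin k` with `3 (k − 3)` edges is exactly `m k − 6 (k − 7)`.
Axioms: standard.
-/

namespace PercRepro

namespace TriangleCap

namespace C047

open Finset

universe u

variable {V : Type*} [Fintype V] [DecidableEq V]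

/-- The convexity term of the row `a = 4`: `4 ≤ d ≤ k − 4` ⇒ `d² + 4 (k − 4) ≤ k d`. -/
theorem convex_vertex_four (d k : ℕ) (h4 : 4 ≤ d) (hd : d + 4 ≤ k) : d * d + 4 * (k - 4) ≤ k * d := by
  obtain ⟨a, rfl⟩ : ∃ a, d = a + 4 := ⟨d - 4, by omega⟩
  obtain ⟨b, rfl⟩ : ∃ b, k = a + 4 + 4 + b := ⟨k - (a + 4 + 4), by omega⟩
  have e1 : a + 4 + 4 + b - 4 = a + 4 + b := by omega
  rw [e1]
  nlinarith [Nat.zero_le (a * b)]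

omit [DecidableEq V] in
/-- **EVERY DEGREE IN `[4, k − 4]` ON THE DIAGONAL:** `Σ_v d(v)² + k (k − 7) ≤ m k` for `m + 9 = 3k`. -/
theorem diag_convex (D : SimpleGraph V) [DecidableRel D.Adj] (hk : 7 ≤ Fintype.card V)
    (hm : D.edgeFinset.card + 9 = 3 * Fintype.card V) (hcap : ∀ v, deg D v + 4 ≤ Fintype.card V)
    (hdeg : ∀ v, 4 ≤ deg D v) :
    ∑ v, deg D v * deg D v + Fintype.card V * (Fintype.card V - 7) ≤ D.edgeFinset.card * Fintype.card V := by
  have hsum : ∑ v, (deg D v * deg D v + 4 * (Fintype.card V - 4)) ≤ ∑ v, Fintype.card V * deg D v :=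
    sum_le_sum (fun v _ => convex_vertex_four (deg D v) (Fintype.card V) (hdeg v) (hcap v))
  rw [sum_add_distrib, sum_const, card_univ, smul_eq_mul, ← mul_sum, sum_deg_eq] at hsum
  obtain ⟨k, hk'⟩ : ∃ k, Fintype.card V = k := ⟨_, rfl⟩
  obtain ⟨m, hm'⟩ : ∃ m, D.edgeFinset.card = m := ⟨_, rfl⟩
  obtain ⟨S, hS⟩ : ∃ S, ∑ v, deg D v * deg D v = S := ⟨_, rfl⟩
  rw [hk', hm'] at hsum hm
  rw [hk'] at hk
  rw [hS] at hsum ⊢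
  rw [hk', hm']
  obtain ⟨t, rfl⟩ : ∃ t, k = t + 7 := ⟨k - 7, by omega⟩
  obtain rfl : m = 3 * t + 12 := by omega
  have e1 : t + 7 - 4 = t + 3 := by omega
  have e2 : t + 7 - 7 = t := by omega
  rw [e1] at hsum
  rw [e2]
  nlinarith [hsum]

/-- A spanning subgraph of `K(A, Aᶜ)` with all `|A| (k − |A|)` cross pairs present is complete bipartite. -/
theorem adj_of_bipSub_full (D : SimpleGraph V) [DecidableRel D.Adj] (A : Finset V) (hA : BipSub D A) (a : ℕ)
    (hAcard : A.card = a) (hm : D.edgeFinset.card = a * (Fintype.card V - a)) {x y : V} (hx : x ∈ A)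
    (hy : y ∉ A) : D.Adj x y := by
  by_contra h
  have h0 := card_edges_missingGraph D A hA a 0 hAcard (by omega)
  have hmem : s(x, y) ∈ (missingGraph D A).edgeFinset := by
    rw [SimpleGraph.mem_edgeFinset, SimpleGraph.mem_edgeSet, missingGraph_adj]
    exact ⟨by tauto, h⟩
  rw [card_eq_zero] at h0
  rw [h0] at hmem
  exact absurd hmem (Finset.notMem_empty _)

/-- **THE CROSS-ROW ARITHMETIC ON THE DIAGONAL** (`r = 0`, `d ≤ 2`, `k = k5 + 5`, `D − z` on the cell
`(k − 1, 4, k − 11 + d)`): the target `6 (k − 7)`. -/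
theorem cross_arith_zero (d k5 m' S' T Q r'' : ℕ) (hd : d ≤ 2) (hk : 11 ≤ k5 + 5 + d)
    (hm : m' + d + 9 = 3 * (k5 + 5)) (hr'' : r'' + 11 = k5 + 5 + d) (hQ : Q + d = 9)
    (hS' : S' + r'' * Q ≤ m' * (k5 + 4)) (hT : T ≤ d * k5) :
    S' + 2 * T + d + d * d + 6 * (k5 - 2) ≤ (m' + d) * (k5 + 5) := by
  interval_cases d
  · obtain ⟨t, rfl⟩ : ∃ t, k5 = t + 6 := ⟨k5 - 6, by omega⟩
    obtain rfl : t = r'' := by omega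
    obtain rfl : Q = 9 := by omega
    obtain rfl : m' = 3 * t + 24 := by omega
    have e2 : t + 6 - 2 = t + 4 := by omega
    nlinarith [hS', hT, e2]
  · obtain ⟨t, rfl⟩ : ∃ t, k5 = t + 5 := ⟨k5 - 5, by omega⟩
    obtain rfl : t = r'' := by omega
    obtain rfl : Q = 8 := by omega
    obtain rfl : m' = 3 * t + 20 := by omega
    have e2 : t + 5 - 2 = t + 3 := by omega
    nlinarith [hS', hT, e2]
  · obtain ⟨t, rfl⟩ : ∃ t, k5 = t + 4 := ⟨k5 - 4, by omega⟩
    obtain rfl : t = r'' := by omega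
    obtain rfl : Q = 7 := by omega
    obtain rfl : m' = 3 * t + 16 := by omega
    have e2 : t + 4 - 2 = t + 2 := by omega
    nlinarith [hS', hT, e2]

/-- **THE CROSS-ROW CASE ON THE DIAGONAL:** `m + 9 = 3k`, `7 ≤ k`, every degree `≤ k − 4`, a vertex `z` of degree
`≤ 2` ⇒ `Σ_v d(v)² + 6 (k − 7) ≤ m k`. -/
theorem three_row_cross_zero (D : SimpleGraph V) [DecidableRel D.Adj] (hK : K4mFree D)
    (hk : 7 ≤ Fintype.card V) (hm : D.edgeFinset.card + 9 = 3 * Fintype.card V)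
    (hcap : ∀ v, deg D v + 4 ≤ Fintype.card V) (z : V) (hz : deg D z ≤ 2) :
    ∑ v, deg D v * deg D v + 6 * (Fintype.card V - 7) ≤ D.edgeFinset.card * Fintype.card V := by
  have hK' := k4mFree_del D hK z
  have hcard' := card_del z
  have hedges' := card_edges_del D z
  have hsq := sum_deg_sq_del D z
  have hT := sum_del_nbhd_le D z (Fintype.card V - 5) (fun v => by have := hcap v; omega)
  obtain ⟨d, hd⟩ : ∃ d, deg D z = d := ⟨_, rfl⟩
  rw [hd] at hz hedges' hsq hT
  obtain ⟨k5, hk5⟩ : ∃ k5, Fintype.card V = k5 + 5 := ⟨Fintype.card V - 5, by omega⟩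
  have hk5' : Fintype.card {v : V // v ≠ z} = k5 + 4 := by omega
  obtain ⟨T, hTdef⟩ : ∃ T, ∑ a : {v : V // v ≠ z}, (if D.Adj a.1 z then deg (del D z) a else 0) = T := ⟨_, rfl⟩
  rw [hTdef] at hsq hT
  obtain ⟨S', hS'def⟩ : ∃ S', ∑ a : {v : V // v ≠ z}, deg (del D z) a * deg (del D z) a = S' := ⟨_, rfl⟩
  rw [hS'def] at hsq
  obtain ⟨m', hm'def⟩ : ∃ m', (del D z).edgeFinset.card = m' := ⟨_, rfl⟩
  rw [hm'def] at hedges'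
  rcases Nat.lt_or_ge (k5 + 5 + d) 11 with hsmall | hlarge
  · exfalso
    have h4 := four_mul_card_edges_le_sq (del D z) hK' (by omega)
    rw [hm'def, hk5'] at h4
    have hk52 : 2 ≤ k5 := by omega
    have hk55 : k5 ≤ 5 := by omega
    rw [hk5] at hm
    interval_cases k5 <;> interval_cases d <;> omega
  · obtain ⟨r'', hr''⟩ : ∃ r'', r'' + 11 = k5 + 5 + d := ⟨k5 + 5 + d - 11, by omega⟩
    have hcell := closed_form_stability (del D z) hK' 4 r'' (by norm_num) (by omega) (by omega)
    rw [hS'def, hm'def, hk5'] at hcell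
    have hQ : k5 + 4 - 1 - r'' = 9 - d := by omega
    rw [hQ] at hcell
    obtain ⟨Q, hQdef⟩ : ∃ Q, Q + d = 9 := ⟨9 - d, by omega⟩
    have hQ' : 9 - d = Q := by omega
    rw [hQ'] at hcell
    rw [hk5] at hT hm ⊢
    have e1 : k5 + 5 - 5 = k5 := by omega
    have e3 : k5 + 5 - 7 = k5 - 2 := by omega
    rw [e1] at hT
    rw [e3, hsq, ← hedges']
    exact cross_arith_zero d k5 m' S' T Q r'' hz hlarge (by omega) hr'' hQdef hcell hT

/-- **THE DIAGONAL `r = 0` AT SECOND ORDER, EVERY VERTEX TYPE, BY INDUCTION ON `k`:** `K₄⁻`-free, `m + 9 = 3k`,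
`7 ≤ k` ⇒ `3`-bipartite or `Σ_v d(v)² + 6 (k − 7) ≤ m k`. -/
theorem diag_second_order_aux (n : ℕ) :
    ∀ (W : Type u) [Fintype W] [DecidableEq W] (D : SimpleGraph W) [DecidableRel D.Adj], Fintype.card W = n →
      K4mFree D → 7 ≤ Fintype.card W → D.edgeFinset.card + 9 = 3 * Fintype.card W →
      (∃ A : Finset W, A.card = 3 ∧ BipSub D A) ∨
        ∑ v, deg D v * deg D v + 6 * (Fintype.card W - 7) ≤ D.edgeFinset.card * Fintype.card W := by
  refine Nat.strong_induction_on n ?_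
  intro n ih W _ _ D _ hn hK hk hm
  -- `k = 7`: the envelope
  rcases Nat.lt_or_ge (Fintype.card W) 8 with hk7 | hk8
  · right
    have h := sum_deg_sq_le_of_k4mFree D hK (by omega)
    have : Fintype.card W - 7 = 0 := by omega
    rw [this]
    simpa using h
  -- (A) a vertex at the cap `k − 3` makes `D` `3`-bipartite
  by_cases hx : ∃ x, deg D x + 3 = Fintype.card W
  · obtain ⟨x, hx⟩ := hx
    rcases three_row_cap D hK 0 (by omega) (by omega) x hx with h | ⟨h1, -⟩
    · exact Or.inl h
    · omega
  push Not at hx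
  have hcap : ∀ v, deg D v + 3 ≤ Fintype.card W := fun v =>
    deg_add_le_card_of_dense D hK 3 (by norm_num) (by omega)
      (cap_arith 3 (Fintype.card W) D.edgeFinset.card 0 (by norm_num) (by omega) (by omega)) v
  have hcap' : ∀ v, deg D v + 4 ≤ Fintype.card W := fun v => by
    have h1 := hcap v
    have h2 := hx v
    omega
  -- (B) every degree `≥ 4`: the convexity of the row `a = 4`
  by_cases hdeg : ∀ v, 4 ≤ deg D v
  · right
    have h := diag_convex D hk hm hcap' hdeg
    have h2 : 6 * (Fintype.card W - 7) ≤ Fintype.card W * (Fintype.card W - 7) :=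
      Nat.mul_le_mul_right _ (by omega)
    omega
  push Not at hdeg
  obtain ⟨z, hz⟩ := hdeg
  -- (C) a vertex of degree `≤ 2`: the cross-row deletion
  rcases Nat.lt_or_ge (deg D z) 3 with hz2 | hz3
  · exact Or.inr (three_row_cross_zero D hK hk hm hcap' z (by omega))
  -- (D) a vertex `z` of degree `3`: deleted onto the diagonal at `k − 1`
  have hz3' : deg D z = 3 := by omega
  have hK' := k4mFree_del D hK z
  have hcard' := card_del z
  have hedges' := card_edges_del D z
  have hsq := sum_deg_sq_del D z
  rw [hz3'] at hedges' hsq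
  have hm' : (del D z).edgeFinset.card + 9 = 3 * Fintype.card {v : W // v ≠ z} := by omega
  have hT := sum_del_nbhd_le D z (Fintype.card W - 5) (fun v => by have := hcap' v; omega)
  rw [hz3'] at hT
  obtain ⟨T, hTdef⟩ : ∃ T, ∑ a : {v : W // v ≠ z}, (if D.Adj a.1 z then deg (del D z) a else 0) = T := ⟨_, rfl⟩
  obtain ⟨S', hS'def⟩ : ∃ S', ∑ a : {v : W // v ≠ z}, deg (del D z) a * deg (del D z) a = S' := ⟨_, rfl⟩
  obtain ⟨m', hm'def⟩ : ∃ m', (del D z).edgeFinset.card = m' := ⟨_, rfl⟩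
  rw [hTdef, hS'def] at hsq
  rw [hTdef] at hT
  have hm'' : m' + 9 = 3 * Fintype.card {v : W // v ≠ z} := by rw [← hm'def]; exact hm'
  rw [hm'def] at hedges'
  obtain ⟨s, hs⟩ : ∃ s, Fintype.card W = s + 8 := ⟨Fintype.card W - 8, by omega⟩
  have hcardW' : Fintype.card {v : W // v ≠ z} = s + 7 := by omega
  rcases ih (Fintype.card {v : W // v ≠ z}) (by omega) {v : W // v ≠ z} (del D z) rfl hK' (by omega) hm'
    with ⟨A', hA'card, hA'⟩ | hgap
  · -- `D − z` is `K_{3,k−4}`: the three neighbours of `z` are on one side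
    have hfull : ∀ {x y : {v : W // v ≠ z}}, x ∈ A' → y ∉ A' → (del D z).Adj x y := fun hx hy =>
      adj_of_bipSub_full (del D z) A' hA' 3 hA'card (by omega) hx hy
    by_cases hall : ∀ a : {v : W // v ≠ z}, D.Adj a.1 z → a ∈ A'
    · obtain ⟨B, hBcard, hB⟩ := bipSub_lift D z A' hA' hall
      exact Or.inl ⟨B, by rw [hBcard, hA'card], hB⟩
    · push Not at hall
      obtain ⟨a₀, ha₀z, ha₀A⟩ := hall
      right
      -- every neighbour of `z` is off `A'`
      have hoff : ∀ a : {v : W // v ≠ z}, D.Adj a.1 z → a ∉ A' := by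
        intro a₁ ha₁z ha₁A
        -- a third neighbour `a₂`
        have hne01 : a₀ ≠ a₁ := fun h => ha₀A (h ▸ ha₁A)
        obtain ⟨a₂, ha₂z, ha₂0, ha₂1⟩ : ∃ a₂ : {v : W // v ≠ z}, D.Adj a₂.1 z ∧ a₂ ≠ a₀ ∧ a₂ ≠ a₁ := by
          have hcard3 : (univ.filter (fun a : {v : W // v ≠ z} => D.Adj a.1 z)).card = 3 := by
            have h := sum_del_nbhd_const D z 1
            rw [hz3', mul_one, ← card_filter] at h
            exact h
          have h2 : 2 < (univ.filter (fun a : {v : W // v ≠ z} => D.Adj a.1 z)).card := by omega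
          obtain ⟨b₁, hb₁, b₂, hb₂, b₃, hb₃, h12, h13, h23⟩ := two_lt_card.mp h2
          rw [mem_filter] at hb₁ hb₂ hb₃
          by_cases e1 : b₁ = a₀ ∨ b₁ = a₁
          · by_cases e2 : b₂ = a₀ ∨ b₂ = a₁
            · refine ⟨b₃, hb₃.2, ?_, ?_⟩
              · intro h; rcases e1 with rfl | rfl <;> rcases e2 with rfl | rfl <;>
                  first | exact h12 rfl | exact h13 h | exact h13 h.symm | exact h23 h | exact h23 h.symm
              · intro h; rcases e1 with rfl | rfl <;> rcases e2 with rfl | rfl <;>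
                  first | exact h12 rfl | exact h13 h | exact h13 h.symm | exact h23 h | exact h23 h.symm
            · push Not at e2
              exact ⟨b₂, hb₂.2, e2.1, e2.2⟩
          · push Not at e1
            exact ⟨b₁, hb₁.2, e1.1, e1.2⟩
        -- `a₁ ∈ A'`, `a₀ ∉ A'`, so `a₁ ∼ a₀` in `D`
        have h10 : D.Adj a₁.1 a₀.1 := (del_adj D z a₁ a₀).mp (hfull ha₁A ha₀A)
        by_cases ha₂A : a₂ ∈ A'
        · have h20 : D.Adj a₂.1 a₀.1 := (del_adj D z a₂ a₀).mp (hfull ha₂A ha₀A)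
          -- the triangles `z a₁ a₀` and `z a₂ a₀` share `z a₀`
          exact not_adj_both D hK (D.adj_symm ha₀z) (D.adj_symm ha₁z) (D.adj_symm h10)
            (fun h => ha₂1 (Subtype.ext h).symm) (D.adj_symm ha₂z) (D.adj_symm h20)
        · have h12' : D.Adj a₁.1 a₂.1 := (del_adj D z a₁ a₂).mp (hfull ha₁A ha₂A)
          -- the triangles `z a₁ a₀` and `z a₁ a₂` share `z a₁`
          exact not_adj_both D hK (D.adj_symm ha₁z) (D.adj_symm ha₀z) h10
            (fun h => ha₂0 (Subtype.ext h).symm) (D.adj_symm ha₂z) h12'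
      -- the neighbours of `z` have degree `≤ 3` in `D − z`
      have hT3 : T ≤ 9 := by
        rw [← hTdef]
        have h1 : ∑ a : {v : W // v ≠ z}, (if D.Adj a.1 z then deg (del D z) a else 0) ≤
            ∑ a : {v : W // v ≠ z}, (if D.Adj a.1 z then 3 else 0) := by
          apply sum_le_sum
          intro a _
          by_cases h : D.Adj a.1 z
          · simp only [h, if_true]
            have := deg_le_card_of_bipSub (del D z) A' hA' a (hoff a h)
            rw [hA'card] at this
            exact this
          · simp [h]
        have h2 := sum_del_nbhd_const D z 3
        rw [hz3'] at h2
        omega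
      have henv := sum_deg_sq_le_of_k4mFree (del D z) hK' (by omega)
      rw [hS'def, hm'def, hcardW'] at henv
      rw [hsq, ← hedges', hs]
      have e1 : s + 8 - 7 = s + 1 := by omega
      rw [e1]
      obtain rfl : m' = 3 * s + 12 := by omega
      nlinarith [henv, hT3]
  · -- `D − z` is `6 (k − 8)` below: the neighbours of `z` at `≤ k − 5` close the count
    right
    rw [hS'def, hm'def, hcardW'] at hgap
    have e0 : s + 7 - 7 = s := by omega
    rw [e0] at hgap
    rw [hs] at hT
    have e1 : s + 8 - 5 = s + 3 := by omega
    rw [e1] at hT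
    rw [hsq, ← hedges', hs]
    have e2 : s + 8 - 7 = s + 1 := by omega
    rw [e2]
    obtain rfl : m' = 3 * s + 12 := by omega
    nlinarith [hgap, hT]

/-- **THE DIAGONAL `r = 0` AT SECOND ORDER:** `K₄⁻`-free, `m + 9 = 3k`, `7 ≤ k` ⇒ `D` is a spanning subgraph of
some `K(A, Aᶜ)` with `|A| = 3`, or `Σ_v d(v)² + 6 (k − 7) ≤ m k`. -/
theorem diag_second_order (D : SimpleGraph V) [DecidableRel D.Adj] (hK : K4mFree D)
    (hk : 7 ≤ Fintype.card V) (hm : D.edgeFinset.card + 9 = 3 * Fintype.card V) :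
    (∃ A : Finset V, A.card = 3 ∧ BipSub D A) ∨
      ∑ v, deg D v * deg D v + 6 * (Fintype.card V - 7) ≤ D.edgeFinset.card * Fintype.card V :=
  diag_second_order_aux (Fintype.card V) V D rfl hK hk hm

/-- `K_{4,k−4}` minus a `(k − 7)`-star is not a spanning subgraph of any `K(A, Aᶜ)` with `|A| = 3` (`k ≥ 8`):
such a graph with `3 (k − 3)` edges is `K_{3,k−3}` with `Σ_v d(v)² = m k`, but the witness is `6 (k − 7)` below. -/
theorem not_three_bipSub_of_below (D : SimpleGraph V) [DecidableRel D.Adj] (hk : 8 ≤ Fintype.card V)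
    (hm : D.edgeFinset.card + 9 = 3 * Fintype.card V)
    (hS : ∑ v, deg D v * deg D v + 6 * (Fintype.card V - 7) = D.edgeFinset.card * Fintype.card V) :
    ¬ ∃ A : Finset V, A.card = 3 ∧ BipSub D A := by
  rintro ⟨A, hAcard, hA⟩
  have hne' : Nonempty V := Fintype.card_pos_iff.mp (by omega)
  obtain ⟨v⟩ := hne'
  have hstar : MissingStar D A v := by
    intro x y hx hy hxy
    exact absurd (adj_of_bipSub_full D A hA 3 hAcard (by omega) hx hy) hxy
  have h := closed_form_eq_of_missingStar D A hA hstar 3 0 hAcard (by omega) (by omega)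
  simp only [zero_mul, add_zero] at h
  omega

/-- **THE WITNESS ON THE DIAGONAL:** `bipMinusStar k 4 (k − 7)` is `K₄⁻`-free with `3 (k − 3)` edges and
`Σ_v d(v)² + 6 (k − 7) = m k` (`k ≥ 8`). -/
theorem diag_witness (k : ℕ) (hk : 8 ≤ k) :
    K4mFree (bipMinusStar k 4 (k - 7)) ∧ (bipMinusStar k 4 (k - 7)).edgeFinset.card + 9 = 3 * k ∧
      ∑ v, deg (bipMinusStar k 4 (k - 7)) v * deg (bipMinusStar k 4 (k - 7)) v + 6 * (k - 7) =
        (bipMinusStar k 4 (k - 7)).edgeFinset.card * k := by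
  have hE := card_edges_bipMinusStar k 4 (k - 7) (by norm_num) (by omega)
  have hS := (sums_bipMinusStar k 4 (k - 7) (by norm_num) (by omega)).2
  refine ⟨k4mFree_bipMinusStar k 4 (k - 7), by omega, ?_⟩
  obtain ⟨S, hSdef⟩ : ∃ S, ∑ v, deg (bipMinusStar k 4 (k - 7)) v * deg (bipMinusStar k 4 (k - 7)) v = S :=
    ⟨_, rfl⟩
  obtain ⟨E, hEdef⟩ : ∃ E, (bipMinusStar k 4 (k - 7)).edgeFinset.card = E := ⟨_, rfl⟩
  rw [hSdef] at hS ⊢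
  rw [hEdef] at hE ⊢
  obtain ⟨t, rfl⟩ : ∃ t, k = t + 8 := ⟨k - 8, by omega⟩
  have e1 : t + 8 - 7 = t + 1 := by omega
  have e2 : t + 8 - 4 = t + 4 := by omega
  have e3 : 2 * (t + 8) - (t + 1) - 1 = t + 14 := by omega
  rw [e1, e2, e3] at hS
  rw [e1, e2] at hE
  rw [e1]
  obtain rfl : E = 3 * t + 15 := by omega
  nlinarith [hS]

/-- **THE SECOND-BEST VALUE ON THE DIAGONAL OF THE ROW `a = 3`:** for `k ≥ 8`, every non-extremal `K₄⁻`-free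
graph on `Fin k` with `3 (k − 3)` edges has `Σ_v d(v)² + 6 (k − 7) ≤ m k`, and the value is attained
(`K_{4,k−4}` minus a `(k − 7)`-star). -/
theorem three_row_second_best_zero (k : ℕ) (hk : 8 ≤ k) :
    (∀ (D : SimpleGraph (Fin k)) [DecidableRel D.Adj], K4mFree D → D.edgeFinset.card + 9 = 3 * k →
        ∑ v, deg D v * deg D v ≠ D.edgeFinset.card * k →
        ∑ v, deg D v * deg D v + 6 * (k - 7) ≤ D.edgeFinset.card * k) ∧
      ∃ (D : SimpleGraph (Fin k)) (_ : DecidableRel D.Adj), K4mFree D ∧ D.edgeFinset.card + 9 = 3 * k ∧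
        ∑ v, deg D v * deg D v + 6 * (k - 7) = D.edgeFinset.card * k := by
  have hcard : Fintype.card (Fin k) = k := Fintype.card_fin k
  refine ⟨?_, ?_⟩
  · intro D _ hK hm hne
    rcases diag_second_order D hK (by omega) (by omega) with ⟨A, hAcard, hA⟩ | h
    · exfalso
      apply hne
      have hne' : Nonempty (Fin k) := Fintype.card_pos_iff.mp (by omega)
      obtain ⟨v⟩ := hne'
      have hstar : MissingStar D A v := by
        intro x y hx hy hxy
        exact absurd (adj_of_bipSub_full D A hA 3 hAcard (by omega) hx hy) hxy
      have h := closed_form_eq_of_missingStar D A hA hstar 3 0 hAcard (by omega) (by omega)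
      simp only [zero_mul, add_zero, hcard] at h
      exact h
    · rw [hcard] at h
      exact h
  · obtain ⟨hK, hE, hS⟩ := diag_witness k hk
    exact ⟨bipMinusStar k 4 (k - 7), inferInstance, hK, hE, hS⟩

end C047

end TriangleCap

end PercRepro
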